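import Summits.MatrixMultiplication.OmegaCensus.STPP222TetraIdx

/-!
# ω-census, the pattern `(2,2,2)⁴`: reflection II — configuration entries, the Def-5.1 word, the membership normal form

HONEST FRAMING (pub-omega census; verbatim): lottery ticket; floor = certified bounds/negative ranges.
Census STRUCTURE bookkeeping (question Q7, row `k = 4`: a KERNEL second leg for the lower half `n₄ ≥ 56` on the one cell,
`(ℤ/2)⁵`, that no second census engine reaches), not progress on `ω`.

The configuration entries `gA gB gC` of an assignment `val : V18 → G`, the word `gword`, the membership normal form `NF`, and the KEY FACT
`gword_ne_zero`: a literal instance of the tree's `IsSTPP` (verbatim port of `STPP222CubeClauses.lean` §2 to four triples).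

References: H. Cohn, R. Kleinberg, B. Szegedy, C. Umans, FOCS 2005 (arXiv:math/0511460), Def. 5.1.
Record: pub-omega HOME `pub-omega-eng2-g23/tetra/` (ENG2 gen 23, 2026-08-26): generators `k4gen.py` (clause lists; levels 0–12 are
literally the `(2,2,2)³` words), `search4.py` (Python mirror of this engine, node-for-node equal to the C census engine cfind v1.2
run WITHOUT symmetry flags on `(ℤ/2)⁵`: 48 024 nodes / 4 115 340 clause evaluations, INFEASIBLE), `gen5.py` (the `GL₅(𝔽₂)` cover maps).
-/

open Literature.Computability.AlgebraicComplexity Finset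

namespace Summit.MatrixMultiplication.OmegaCensus

namespace STPP222TetraNeg

/-- The entry of `A t` selected by bit `e`, as a variable (`none` = the fixed entry `0`). -/
def slotA : T4 → Bool → Option V18
  | _, false => none
  | .t0, true => some .a0
  | .t1, true => some .a1
  | .t2, true => some .a2
  | .t3, true => some .a3

/-- The entry of `B t` selected by bit `e`, as a variable (`none` = the fixed entry `0 ∈ B 0`). -/
def slotB : T4 → Bool → Option V18
  | .t0, false => none
  | .t0, true => some .b0
  | .t1, false => some .q1
  | .t1, true => some .q1'
  | .t2, false => some .q2
  | .t2, true => some .q2'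
  | .t3, false => some .q3
  | .t3, true => some .q3'

/-- The entry of `C t` selected by bit `e`, as a variable (`none` = the fixed entry `0 ∈ C 0`). -/
def slotC : T4 → Bool → Option V18
  | .t0, false => none
  | .t0, true => some .c0
  | .t1, false => some .r1
  | .t1, true => some .r1'
  | .t2, false => some .r2
  | .t2, true => some .r2'
  | .t3, false => some .r3
  | .t3, true => some .r3'

/-- Value of an optional variable under an assignment `val` (`none ↦ 0`). -/
def oval {G : Type} [AddCommGroup G] (val : V18 → G) : Option V18 → G
  | none => 0
  | some u => val u

/-- Element `e` of `A t` of the normal-form configuration with unknowns `val`. -/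
def gA {G : Type} [AddCommGroup G] (val : V18 → G) (t : T4) (e : Bool) : G := oval val (slotA t e)

/-- Element `e` of `B t`. -/
def gB {G : Type} [AddCommGroup G] (val : V18 → G) (t : T4) (e : Bool) : G := oval val (slotB t e)

/-- Element `e` of `C t`. -/
def gC {G : Type} [AddCommGroup G] (val : V18 → G) (t : T4) (e : Bool) : G := oval val (slotC t e)

/-- The Def-5.1 word `(s' − s) + (t' − t) + (u' − u)` of an index tuple on the configuration (the tree's `IsSTPP` word
with `s = A k es`, `s' = A i es'`, `t = B i et`, `t' = B j et'`, `u = C j eu`, `u' = C k eu'`). -/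
def gword {G : Type} [AddCommGroup G] (val : V18 → G) (ι : Idx4) : G :=
  (gA val ι.i ι.es' - gA val ι.k ι.es) + (gB val ι.j ι.et' - gB val ι.i ι.et) + (gC val ι.k ι.eu' - gC val ι.j ι.eu)

/-- NORMAL FORM, membership version: the twelve sets contain the entries of the configuration with unknowns `val`
(`0, a t ∈ A t`; `0, b₀ ∈ B 0`; `q t, q' t ∈ B t`; `0, c₀ ∈ C 0`; `r t, r' t ∈ C t`), distinct entries of one set
having distinct bits. -/
structure NF {G : Type} [AddCommGroup G] (SA SB SC : Fin 4 → Finset G) (val : V18 → G) : Prop where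
  /-- `A`-entries are members -/ memA : ∀ t e, gA val t e ∈ SA (fin4 t)
  /-- `B`-entries are members -/ memB : ∀ t e, gB val t e ∈ SB (fin4 t)
  /-- `C`-entries are members -/ memC : ∀ t e, gC val t e ∈ SC (fin4 t)
  /-- `A`-entries of one set are distinct -/ injA : ∀ t e₁ e₂, gA val t e₁ = gA val t e₂ → e₁ = e₂
  /-- `B`-entries of one set are distinct -/ injB : ∀ t e₁ e₂, gB val t e₁ = gB val t e₂ → e₁ = e₂
  /-- `C`-entries of one set are distinct -/ injC : ∀ t e₁ e₂, gC val t e₁ = gC val t e₂ → e₁ = e₂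

/-- KEY FACT (reflection of Def. 5.1): on a genuine normal-form configuration of an STPP family, the word of an index
tuple whose conclusion fails is nonzero. [cite: CohnKleinbergSzegedyUmans2005, Def. 5.1] -/
theorem gword_ne_zero {G : Type} [AddCommGroup G] {SA SB SC : Fin 4 → Finset G} (hS : IsSTPP SA SB SC)
    {val : V18 → G} (hN : NF SA SB SC val) (ι : Idx4) (hc : ι.concl = false) : gword val ι ≠ 0 := by
  intro h0
  obtain ⟨hij, hjk, hs, ht, hu⟩ := hS (fin4 ι.i) (fin4 ι.j) (fin4 ι.k) _ (hN.memA ι.k ι.es) _ (hN.memA ι.i ι.es')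
    _ (hN.memB ι.i ι.et) _ (hN.memB ι.j ι.et') _ (hN.memC ι.j ι.eu) _ (hN.memC ι.k ι.eu') h0
  have hij' := fin4_inj hij
  have hjk' := fin4_inj hjk
  have e1 : ι.es = ι.es' := hN.injA _ _ _ (by rw [← hjk', ← hij'] at hs; exact hs)
  have e2 : ι.et = ι.et' := hN.injB _ _ _ (by rw [← hij'] at ht; exact ht)
  have e3 : ι.eu = ι.eu' := hN.injC _ _ _ (by rw [← hjk'] at hu; exact hu)
  have : ι.concl = true := by simp [Idx4.concl, hij', hjk', e1, e2, e3]
  rw [hc] at this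
  exact Bool.false_ne_true this

end STPP222TetraNeg

end Summit.MatrixMultiplication.OmegaCensus
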